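import Literature.Geometry.Kaehler.HolomorphicChainRectifiable
import Mathlib.Analysis.InnerProductSpace.NormDet
import Mathlib.RingTheory.Norm.Transitivity
import Mathlib.RingTheory.Complex
import Mathlib.LinearAlgebra.Complex.FiniteDimensional
import HarnessLib

/-!
# The complex orientation frame: spans, orthonormality, and the Jacobian factor

Brick R5 of the proof of the named fact
`Literature.Geometry.Kaehler.Harvey1977_boundary_toCurrent_eq_zero`: the linear algebra of the
real `2p`-frame `complexFrame u = (u₀, I u₀, u₁, I u₁, …)` of a complex `p`-frame `u`
(`Literature/Geometry/Kaehler/HolomorphicChain.lean`), with which the current of a holomorphic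
chain is oriented. Everything is proved from Mathlib; no definitions, no named facts. The real
inner product on a complex inner product space is `InnerProductSpace.complexToReal` (introduced
by `letI` inside the statements, as in `HolomorphicChainFacts.lean`).

* `map_complexFrame` — `complexFrame (L ∘ u) = L ∘ complexFrame u` for `ℂ`-linear `L`;
  `span_complexFrame_eq_restrictScalars` — the real span of `complexFrame u` is the complex span
  of `u`, as real submodules (the set-level form is `span_complexFrame_eq`, the real
  orthonormality `orthonormal_complexFrame` and the existence of unitary frames
  `exists_orthonormal_span_complexFrame_eq` are in `HolomorphicChainRectifiable.lean`).
* `AlternatingMap.map_comp_basis_eq_det_mul` — top-degree forms scale by the determinant.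
* `apply_comp_complexFrame_eq_normDet_mul` — **the Jacobian factor**: for a `ℂ`-linear map
  `D : T₀ → V` out of a `p`-dimensional complex inner product space with unitary basis `b`, and
  a unitary `p`-frame `u'` of `V` with `span_ℝ (complexFrame u') = im D`, every real
  `2p`-covector `ω` on `V` satisfies
  `ω (D ∘ complexFrame b) = normDet (D_ℝ) · ω (complexFrame u')`,
  where `normDet D_ℝ = (det (D_ℝᵀ D_ℝ))^{1/2}` is the `2p`-dimensional Jacobian of the
  realification of `D` (Mathlib's `LinearMap.normDet`). Indeed `D = ι ∘ B` with `ι` the unitary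
  map `b ↦ u'` and `B` complex-linear on `T₀`, so `ω (D ∘ complexFrame b) = det_ℝ B ·
  ω (ι ∘ complexFrame b)` (top-degree forms scale by the determinant), `ι ∘ complexFrame b =
  complexFrame u'`, and `det_ℝ B = |det_ℂ B|² = normDet D_ℝ ≥ 0`: complex-linear maps preserve
  the canonical orientation.

## References

* P. Griffiths, J. Harris, *Principles of Algebraic Geometry* (1978), Ch. 0 §2 ("the natural
  orientation … complex manifolds are oriented").
* H. Federer, *Geometric Measure Theory*, Springer 1969, 3.2.1 (Jacobians), 4.2.29 (holomorphic
  chains are oriented by the complex, positive `2m`-vectorfield).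
-/

noncomputable section

open Module Set Submodule
open scoped InnerProductSpace ComplexConjugate

namespace Literature.Geometry.Kaehler

section Frame

variable {V : Type*} [NormedAddCommGroup V] [InnerProductSpace ℂ V] {p : ℕ}

/-- Every index of `Fin (2p)` is `2j` or `2j + 1`. [folklore] -/
theorem exists_fin_two_mul_eq (k : Fin (2 * p)) :
    (∃ j : Fin p, k = ⟨2 * j, by omega⟩) ∨ ∃ j : Fin p, k = ⟨2 * j + 1, by omega⟩ := by
  rcases Nat.even_or_odd (k : ℕ) with ⟨m, hm⟩ | ⟨m, hm⟩
  · exact Or.inl ⟨⟨m, by omega⟩, Fin.ext (by simp; omega)⟩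
  · exact Or.inr ⟨⟨m, by omega⟩, Fin.ext (by simp; omega)⟩

variable {W : Type*} [NormedAddCommGroup W] [InnerProductSpace ℂ W]

/-- **`complexFrame` is natural under complex-linear maps**: `complexFrame (L ∘ u) = L ∘
complexFrame u`. [folklore] -/
theorem map_complexFrame (L : V →ₗ[ℂ] W) (u : Fin p → V) :
    complexFrame (⇑L ∘ u) = ⇑L ∘ complexFrame u := by
  funext k
  rcases exists_fin_two_mul_eq k with ⟨j, rfl⟩ | ⟨j, rfl⟩
  · rw [complexFrame_apply_even, Function.comp_apply, Function.comp_apply,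
      complexFrame_apply_even]
  · rw [complexFrame_apply_odd, Function.comp_apply, Function.comp_apply, complexFrame_apply_odd,
      map_smul]

/-- Every vector of `complexFrame u` lies in the complex span of `u`. [folklore] -/
theorem complexFrame_mem_span (u : Fin p → V) (k : Fin (2 * p)) :
    complexFrame u k ∈ span ℂ (range u) := by
  rcases exists_fin_two_mul_eq k with ⟨j, rfl⟩ | ⟨j, rfl⟩
  · rw [complexFrame_apply_even]; exact subset_span ⟨j, rfl⟩
  · rw [complexFrame_apply_odd]; exact smul_mem _ _ (subset_span ⟨j, rfl⟩)

/-- **The real span of `complexFrame u` is the complex span of `u`** (`Σ cⱼ uⱼ =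
Σ (re cⱼ) uⱼ + (im cⱼ) (I uⱼ)`). [folklore] -/
theorem span_complexFrame_eq_restrictScalars (u : Fin p → V) :
    span ℝ (range (complexFrame u)) = (span ℂ (range u)).restrictScalars ℝ := by
  apply le_antisymm
  · rw [span_le]
    rintro _ ⟨k, rfl⟩
    exact complexFrame_mem_span u k
  · -- the real span is closed under `I •`, hence a complex subspace containing `u`
    have hI : ∀ x ∈ span ℝ (range (complexFrame u)), Complex.I • x ∈ span ℝ (range (complexFrame u)) := by
      intro x hx
      induction hx using span_induction with
      | mem x hx =>
        obtain ⟨k, rfl⟩ := hx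
        rcases exists_fin_two_mul_eq k with ⟨j, rfl⟩ | ⟨j, rfl⟩
        · rw [complexFrame_apply_even, ← complexFrame_apply_odd u j]
          exact subset_span ⟨_, rfl⟩
        · rw [complexFrame_apply_odd, smul_smul, Complex.I_mul_I, neg_one_smul,
            ← complexFrame_apply_even u j]
          exact neg_mem (subset_span ⟨_, rfl⟩)
      | zero => rw [smul_zero]; exact zero_mem _
      | add x y _ _ hx hy => rw [smul_add]; exact add_mem hx hy
      | smul r x _ hx => rw [smul_comm]; exact smul_mem _ r hx
    -- complex scalars act through real parts and `I`
    have hc : ∀ (c : ℂ), ∀ x ∈ span ℝ (range (complexFrame u)),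
        c • x ∈ span ℝ (range (complexFrame u)) := by
      intro c x hx
      have : c • x = (c.re : ℂ) • x + (c.im : ℂ) • (Complex.I • x) := by
        rw [smul_smul, ← add_smul]
        congr 1
        exact (Complex.re_add_im c).symm
      rw [this, Complex.coe_smul, Complex.coe_smul]
      exact add_mem (smul_mem _ _ hx) (smul_mem _ _ (hI x hx))
    intro x hx
    rw [restrictScalars_mem] at hx
    induction hx using span_induction with
    | mem x hx =>
      obtain ⟨j, rfl⟩ := hx
      rw [← complexFrame_apply_even u j]
      exact subset_span ⟨_, rfl⟩
    | zero => exact zero_mem _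
    | add x y _ _ hx hy => exact add_mem hx hy
    | smul c x _ hx => exact hc c x hx

end Frame

/-! ### The Jacobian factor of a complex-linear map on complex frames -/

section Jacobian

variable {T₀ : Type*} [NormedAddCommGroup T₀] [InnerProductSpace ℂ T₀] [FiniteDimensional ℂ T₀]
  {V : Type*} [NormedAddCommGroup V] [InnerProductSpace ℂ V] {p : ℕ}

/-- **Top-degree forms scale by the determinant**: for a real basis `e` of `T₀` indexed by `ι`,
a real endomorphism `B` and an `ℝ`-valued alternating form `η` of degree `ι`,
`η (B ∘ e) = det B · η e`. [folklore] -/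
theorem _root_.AlternatingMap.map_comp_basis_eq_det_mul {ι M : Type*} [Fintype ι]
    [DecidableEq ι] [AddCommGroup M] [Module ℝ M] (e : Basis ι ℝ M) (B : M →ₗ[ℝ] M)
    (η : M [⋀^ι]→ₗ[ℝ] ℝ) : η (⇑B ∘ ⇑e) = B.det * η e := by
  conv_lhs => rw [η.eq_smul_basis_det e]
  rw [AlternatingMap.smul_apply, Basis.det_comp, Basis.det_self, mul_one, smul_eq_mul, mul_comm]

/-- **The Jacobian factor of a complex-linear map on complex frames.** Let `T₀` be a complex
inner product space with unitary basis `b : Fin p → T₀`, `D : T₀ → V` complex-linear, and `u'` a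
unitary `p`-frame of `V` whose complex frame spans `im D` over `ℝ`. Then for every real
`2p`-covector `ω` on `V`,
`ω (D ∘ complexFrame b) = normDet D_ℝ · ω (complexFrame u')`, `D_ℝ` the realification of `D`:
complex-linear maps map the canonical orientation of `T₀` to that of `im D`, with Jacobian
`normDet D_ℝ = det_ℝ (ι⁻¹ D) = |det_ℂ (ι⁻¹ D)|²` for the unitary `ι : b ↦ u'`.
[cite: Federer1969, 4.2.29 (complex orientation), 3.2.1 (Jacobian)] -/
theorem apply_comp_complexFrame_eq_normDet_mul (b : OrthonormalBasis (Fin p) ℂ T₀) (D : T₀ →L[ℂ] V)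
    {u' : Fin p → V} (hu' : Orthonormal ℂ u')
    (hspan : (span ℝ (range (complexFrame u')) : Set V) = range D)
    (ω : V [⋀^Fin (2 * p)]→L[ℝ] ℝ) :
    letI : InnerProductSpace ℝ T₀ := InnerProductSpace.complexToReal
    letI : InnerProductSpace ℝ V := InnerProductSpace.complexToReal
    ω (⇑D ∘ complexFrame b) =
      ((D.restrictScalars ℝ : T₀ →L[ℝ] V) : T₀ →ₗ[ℝ] V).normDet * ω (complexFrame u') := by
  letI : InnerProductSpace ℝ T₀ := InnerProductSpace.complexToReal
  letI : InnerProductSpace ℝ V := InnerProductSpace.complexToReal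
  classical
  -- the image `Q = im D = span_ℂ u'`
  set Q : Submodule ℂ V := LinearMap.range (D : T₀ →ₗ[ℂ] V) with hQ_def
  have hQu : span ℂ (range u') = Q := by
    apply SetLike.coe_injective
    rw [← span_complexFrame_eq, hspan, hQ_def, LinearMap.coe_range]
    rfl
  -- `u'` as an orthonormal basis `bQ` of `Q`
  have hmem : ∀ j, u' j ∈ Q := fun j => hQu ▸ subset_span ⟨j, rfl⟩
  let u'' : Fin p → Q := fun j => ⟨u' j, hmem j⟩
  have hu'' : Orthonormal ℂ u'' := by
    rw [orthonormal_iff_ite] at hu' ⊢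
    intro i j
    rw [Submodule.coe_inner]
    exact hu' i j
  have htop : ⊤ ≤ span ℂ (range u'') := by
    rw [top_le_iff]
    apply Submodule.map_injective_of_injective Q.injective_subtype
    rw [Submodule.map_span, Submodule.map_top, Submodule.range_subtype]
    conv_rhs => rw [← hQu]
    congr 1
    ext x
    simp [u'']
  let bQ : OrthonormalBasis (Fin p) ℂ Q := OrthonormalBasis.mk hu'' htop
  have hbQ : ∀ j, (bQ j : V) = u' j := fun j => by
    simp [bQ, u'']
  -- the unitary `ι : T₀ → V`, `b ↦ u'`, and the factorisation `D = ι ∘ B`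
  let e : T₀ ≃ₗᵢ[ℂ] Q := b.equiv bQ (Equiv.refl _)
  let ι : T₀ →ₗᵢ[ℂ] V := Q.subtypeₗᵢ.comp e.toLinearIsometry
  have hιb : ∀ j, ι (b j) = u' j := fun j => by
    simp [ι, e, hbQ]
  let D₀ : T₀ →L[ℂ] Q := D.codRestrict Q fun x => LinearMap.mem_range_self _ x
  let B : T₀ →L[ℂ] T₀ := (e.symm.toContinuousLinearEquiv : Q →L[ℂ] T₀).comp D₀
  have hDB : ∀ x, D x = ι (B x) := fun x => by
    simp [ι, B, D₀]
  -- realifications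
  let ιℝ : T₀ →ₗᵢ[ℝ] V := ⟨ι.toLinearMap.restrictScalars ℝ, ι.norm_map⟩
  have hιℝ : ∀ x, ιℝ x = ι x := fun _ => rfl
  let Dℝ : T₀ →ₗ[ℝ] V := ((D.restrictScalars ℝ : T₀ →L[ℝ] V) : T₀ →ₗ[ℝ] V)
  let Bℝ : T₀ →ₗ[ℝ] T₀ := (B : T₀ →ₗ[ℂ] T₀).restrictScalars ℝ
  have hDℝ : Dℝ = ιℝ.toLinearMap ∘ₗ Bℝ := by
    ext x
    exact hDB x
  -- `normDet D_ℝ = det_ℝ B ≥ 0`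
  have hdet : Dℝ.normDet = Bℝ.det := by
    have hnonneg : 0 ≤ Bℝ.det := by
      rw [LinearMap.det_restrictScalars, Algebra.norm_complex_apply]
      exact Complex.normSq_nonneg _
    rw [hDℝ, LinearMap.normDet_comp_of_finrank_eq _ _ rfl, LinearIsometry.normDet_eq_one, one_mul,
      LinearMap.normDet_eq_abs_det, abs_of_nonneg hnonneg]
  -- the frames: `D ∘ cF b = ι ∘ (B ∘ cF b)` and `ι ∘ cF b = cF u'`
  have hframe : (⇑D ∘ complexFrame b : Fin (2 * p) → V) = ⇑ιℝ ∘ (⇑Bℝ ∘ complexFrame b) := by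
    funext k
    exact hDB _
  have hιframe : (⇑ιℝ ∘ complexFrame b : Fin (2 * p) → V) = complexFrame u' := by
    have h1 : (⇑ιℝ ∘ complexFrame b : Fin (2 * p) → V) = ⇑ι.toLinearMap ∘ complexFrame b := rfl
    rw [h1, ← map_complexFrame]
    congr 1
    funext j
    exact hιb j
  -- degenerate case `p = 0`
  rcases Nat.eq_zero_or_pos p with rfl | hp
  · haveI hsub : Subsingleton T₀ := by
      have : finrank ℂ T₀ = 0 := by simpa using finrank_eq_card_basis b.toBasis
      exact Module.finrank_zero_iff.1 this
    have h1 : Dℝ.normDet = 1 := LinearMap.normDet_of_subsingleton _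
    have h2 : (⇑D ∘ complexFrame b : Fin (2 * 0) → V) = complexFrame u' :=
      funext fun k => absurd k.2 (by simp)
    change ω (⇑D ∘ complexFrame b) = Dℝ.normDet * ω (complexFrame u')
    rw [h2, h1, one_mul]
  -- `cF b` is a real basis of `T₀`
  haveI : Nonempty (Fin (2 * p)) := ⟨⟨0, by omega⟩⟩
  have hcard : Fintype.card (Fin (2 * p)) = finrank ℝ T₀ := by
    rw [Fintype.card_fin, finrank_real_of_complex, finrank_eq_card_basis b.toBasis, Fintype.card_fin]
  let e₀ : Basis (Fin (2 * p)) ℝ T₀ :=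
    basisOfOrthonormalOfCardEqFinrank (orthonormal_complexFrame b.orthonormal) hcard
  have he₀ : (⇑e₀ : Fin (2 * p) → T₀) = complexFrame b :=
    coe_basisOfOrthonormalOfCardEqFinrank _ _
  -- the pulled-back top form `η = ω ∘ ι` on `T₀` scales by `det_ℝ B`
  let η : T₀ [⋀^Fin (2 * p)]→L[ℝ] ℝ := ω.compContinuousLinearMap ιℝ.toContinuousLinearMap
  have hη : ∀ v : Fin (2 * p) → T₀, η v = ω (⇑ιℝ ∘ v) := fun v =>
    ContinuousAlternatingMap.compContinuousLinearMap_apply _ _ _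
  have hscale : η (⇑Bℝ ∘ complexFrame b) = Bℝ.det * η (complexFrame b) := by
    rw [← he₀]
    exact AlternatingMap.map_comp_basis_eq_det_mul e₀ Bℝ η.toAlternatingMap
  calc ω (⇑D ∘ complexFrame b) = η (⇑Bℝ ∘ complexFrame b) := by rw [hframe, hη]
    _ = Bℝ.det * η (complexFrame b) := hscale
    _ = Dℝ.normDet * ω (complexFrame u') := by rw [hdet, hη, hιframe]

end Jacobian

end Literature.Geometry.Kaehler
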